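import Summits.Ventures.PercRepro.RankLevelSetUpFiveTargets

/-! # RankLevelSetUpFiveBad — THE BAD MEMBERS OF THE COLOOP RESIDUE (P) AND THEIR TYPE-B TARGETS, READ IN `M`
(night-1 g41; dossier §53.3–53.4; on `RankLevelSetUpFiveTargets`)

The residue (P) = `UpFiveDeletionResidue M b` compares `Σ_{W ∈ T_5} c₀ W` with `2 T_5 + Σ_{Z ∈ V_6} c₀' Z`, where
`c₀ W = #{t ∈ E ∖ W : t ∈ cl_M W}` and `c₀' Z = #{t ∈ (E ∖ Z) ∖ {b} : t ∈ cl_M Z}`. A BAD member is a `W ∈ T_5(b)` with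
`c₀ W = 3`. This module reads the dual structure of a bad member (`M` of nullity `5`, coloop-free, without a series
triple, `≥ 12` elements): with `C := {t ∈ E ∖ W : t ∈ cl_M W}` (the coloops of `M✶|(E ∖ W)`) and
`L' := (E ∖ W) ∖ C`, the set `L'` has rank `≤ 2` in `M✶` and `n − 8 ≥ 4` elements (**`bad_line_eRk_le_two`**,
**`bad_line_ncard`**), `W` is a base of `M✶` (**`isBase_dual_of_mem_biIndep_five`**), and the type-B target
`Z := (W ∖ b) ∪ {ℓ, c}` of §53.4 (`ℓ ∈ L'`, `c ∈ C`, `{ℓ, c} ⊄ cl✶ (W ∖ b)`, `L' ∪ (C ∖ c) ∪ {b}` spanning in `M✶`)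
is a member of `V_6(b)` whose coloop count `c₀'` counts every `t ∈ C ∖ c` (**`typeB_target_mem_avoid`**): the
transport of `typeB_target_valid` through `dual_spanning_compl_of_indep` / `indep_of_dual_spanning_compl` and
`compl_closure_eq_dual_coloops`. Every declaration has a docstring; imports: the cell's own modules and Mathlib only.
Axioms: standard. -/

namespace PercRepro

open Set Matroid

variable {α : Type} (M : Matroid α) [M.Finite]

/-! ## The dual reading of a member of `T_5` -/

omit [M.Finite] in
/-- **A bi-independent set is spanning in the dual**: `E ∖ W` independent in `M` makes `W` spanning in `M✶`. -/
lemma dual_spanning_of_mem_biIndep {k : ℕ} {W : Set α} (hW : W ∈ biIndep M k) : M✶.Spanning W := by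
  have h := dual_spanning_compl_of_indep M hW.2.2.2
  rwa [Set.sdiff_sdiff_cancel_left hW.1] at h

/-- **A bi-independent `5`-set of a matroid of nullity `5` is a base of the dual.** -/
lemma isBase_dual_of_mem_biIndep_five (hν : M✶.eRank = 5) {W : Set α} (hW : W ∈ biIndep M 5) : M✶.IsBase W := by
  obtain ⟨B, hB, hBW⟩ := (dual_spanning_of_mem_biIndep M hW).exists_isBase_subset
  have hWfin : W.Finite := M.ground_finite.subset hW.1
  have hBcard : B.encard = 5 := by rw [hB.encard_eq_eRank, hν]
  have hWcard : W.encard = 5 := by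
    rw [hWfin.encard_eq_coe_toFinset_card, ← Set.ncard_eq_toFinset_card _ hWfin, hW.2.1]; rfl
  have : B = W := (hWfin.subset hBW).eq_of_subset_of_encard_le hBW (by rw [hBcard, hWcard])
  rw [← this]; exact hB

omit [M.Finite] in
/-- **The no-series-triple hypothesis, read in the dual**: no three distinct elements of `E` are pairwise parallel
in `M✶`. -/
lemma dual_no_parallel_triple (hcol : ∀ e, ¬ M.IsColoop e) (hnt : NoSeriesTriple M) :
    ∀ p ∈ M✶.E, ∀ q ∈ M✶.E, ∀ r ∈ M✶.E, p ≠ q → p ≠ r → q ≠ r → q ∈ M✶.closure {p} → r ∉ M✶.closure {p} := by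
  intro p hp q _ r _ hpq hpr hqr hq hr
  rw [Matroid.dual_ground] at hp
  exact hnt p q r hpq hpr hqr (dual_isNonloop_of_coloopFree M hcol hp) hq hr

/-! ## The line of a bad member -/

/-- **The rank of `E ∖ W` in the dual splits along the coloops**: for `W ∈ biIndep M k`, with
`C := {t ∈ E ∖ W : t ∈ cl_M W}` (the coloops of `M✶|(E ∖ W)`), `rk✶ (E ∖ W) = rk✶ ((E ∖ W) ∖ C) + #C`. -/
lemma eRk_dual_compl_eq_add_coloops {k : ℕ} {W : Set α} (hW : W ∈ biIndep M k) :
    M✶.eRk (M.E \ W) =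
      M✶.eRk ((M.E \ W) \ {t ∈ M.E \ W | t ∈ M.closure W}) + ({t ∈ M.E \ W | t ∈ M.closure W}.ncard : ℕ∞) := by
  classical
  set Y := M.E \ W with hYdef
  set C := {t ∈ M.E \ W | t ∈ M.closure W} with hCdef
  have hCdual : C = {t ∈ Y | t ∉ M✶.closure (Y \ {t})} := compl_closure_eq_dual_coloops M hW
  have hYfin : Y.Finite := M.ground_finite.subset Set.sdiff_subset
  have hCY : C ⊆ Y := fun t ht => ht.1
  have hCfin : C.Finite := hYfin.subset hCY
  have hYE : Y ⊆ M✶.E := by rw [Matroid.dual_ground]; exact Set.sdiff_subset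
  set Y' := Y \ C with hY'
  have hsplit : Y = Y' ∪ ↑hCfin.toFinset := by
    rw [hCfin.coe_toFinset, Set.sdiff_union_of_subset hCY]
  have hsk : ∀ d ∈ hCfin.toFinset, d ∉ M✶.closure (Y' ∪ (↑hCfin.toFinset \ {d})) := by
    intro d hd
    rw [hCfin.mem_toFinset] at hd
    have hd' : d ∉ M✶.closure (Y \ {d}) := by rw [hCdual] at hd; exact hd.2
    intro h
    apply hd'
    refine M✶.closure_subset_closure ?_ h
    rw [hCfin.coe_toFinset]
    intro x hx
    rcases hx with hx | hx
    · exact ⟨hx.1, fun h => hx.2 (by rw [Set.mem_singleton_iff] at h; rw [h]; exact hd)⟩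
    · exact ⟨hCY hx.1, hx.2⟩
  have hrk : M✶.eRk Y = M✶.eRk Y' + (hCfin.toFinset.card : ℕ∞) := by
    rw [hsplit]
    exact eRk_union_eq_add_encard_of_forall_notMem_closure hCfin.toFinset
      (by rw [hCfin.coe_toFinset]; exact hCY.trans hYE) hsk
  have hCcard : hCfin.toFinset.card = C.ncard := (Set.ncard_eq_toFinset_card C hCfin).symm
  rw [hrk, hCcard]

/-- **The line of a bad member has rank `≤ 2` in the dual**: `M` of nullity `≤ 5`, `W ∈ biIndep M 5` with three
coloops `C` of `M✶|(E ∖ W)`; then `rk✶ ((E ∖ W) ∖ C) ≤ 2`. -/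
lemma bad_line_eRk_le_two (hν : M✶.eRank ≤ 5) {W : Set α} (hW : W ∈ biIndep M 5)
    (hC3 : {t ∈ M.E \ W | t ∈ M.closure W}.ncard = 3) :
    M✶.eRk ((M.E \ W) \ {t ∈ M.E \ W | t ∈ M.closure W}) ≤ 2 := by
  have h := eRk_dual_compl_eq_add_coloops M hW
  rw [hC3] at h
  have h5 : M✶.eRk (M.E \ W) ≤ 5 := (M✶.eRk_le_eRank _).trans hν
  rw [h] at h5
  have h5' : M✶.eRk ((M.E \ W) \ {t ∈ M.E \ W | t ∈ M.closure W}) + 3 ≤ 2 + 3 := by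
    calc M✶.eRk ((M.E \ W) \ {t ∈ M.E \ W | t ∈ M.closure W}) + 3 ≤ 5 := by exact_mod_cast h5
      _ = 2 + 3 := by norm_num
  exact (WithTop.add_le_add_iff_right (by simp : (3 : ℕ∞) ≠ ⊤)).mp h5'

/-- **The line of a bad member has `n − 8` points**: for `W ∈ biIndep M 5` with three coloops,
`#((E ∖ W) ∖ C) = #E − 8`. -/
lemma bad_line_ncard {W : Set α} (hW : W ∈ biIndep M 5) (hC3 : {t ∈ M.E \ W | t ∈ M.closure W}.ncard = 3) :
    ((M.E \ W) \ {t ∈ M.E \ W | t ∈ M.closure W}).ncard = M.E.ncard - 8 := by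
  have hYfin : (M.E \ W).Finite := M.ground_finite.subset Set.sdiff_subset
  have hCY : {t ∈ M.E \ W | t ∈ M.closure W} ⊆ M.E \ W := fun t ht => ht.1
  rw [Set.ncard_sdiff hCY (hYfin.subset hCY), hC3, Set.ncard_sdiff' hW.1 M.ground_finite, hW.2.1]
  omega

/-! ## The type-B target, read in `M` -/

/-- **THE TYPE-B TARGET OF A BAD MEMBER IS A MEMBER OF `V_6(b)` WHOSE COLOOP COUNT SEES EVERY `t ∈ C ∖ c`**
(night-1 g41, §53.4, the transport of `typeB_target_valid`): `M` coloop-free, without a series triple, of nullity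
`5`, with `≥ 12` elements; `W ∈ biIndep M 5`, `b ∈ W`, `C := {t ∈ E ∖ W : t ∈ cl_M W}` of three elements,
`L' := (E ∖ W) ∖ C`; `ℓ ∈ L'`, `c ∈ C`, `{ℓ, c} ⊄ cl✶ (W ∖ b)`, `L' ∪ (C ∖ c) ∪ {b}` spanning in `M✶`. Then
`Z := (W ∖ b) ∪ {ℓ, c}` is in `biIndep M 6`, avoids `b`, and every `t ∈ C ∖ c` lies in
`{t ∈ (E ∖ Z) ∖ {b} : t ∈ cl_M Z}`. -/
theorem typeB_target_mem_avoid (hν : M✶.eRank = 5) (hcol : ∀ e, ¬ M.IsColoop e) (hnt : NoSeriesTriple M)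
    (hn : 12 ≤ M.E.ncard) {W : Set α} (hW : W ∈ biIndep M 5) {b : α} (hb : b ∈ W)
    (hC3 : {t ∈ M.E \ W | t ∈ M.closure W}.ncard = 3) {ℓ c : α}
    (hℓ : ℓ ∈ (M.E \ W) \ {t ∈ M.E \ W | t ∈ M.closure W}) (hc : c ∈ {t ∈ M.E \ W | t ∈ M.closure W})
    (hZ : ¬ ({ℓ, c} ⊆ M✶.closure (W \ {b})))
    (hval : M✶.Spanning (((M.E \ W) \ {t ∈ M.E \ W | t ∈ M.closure W}) ∪
      ({t ∈ M.E \ W | t ∈ M.closure W} \ {c}) ∪ {b})) :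
    (W \ {b}) ∪ {ℓ, c} ∈ biIndep M 6 ∧ b ∉ (W \ {b}) ∪ {ℓ, c} ∧
      ∀ t ∈ {t ∈ M.E \ W | t ∈ M.closure W} \ {c},
        t ∈ {t ∈ (M.E \ ((W \ {b}) ∪ {ℓ, c})) \ {b} | t ∈ M.closure ((W \ {b}) ∪ {ℓ, c})} := by
  classical
  set C := {t ∈ M.E \ W | t ∈ M.closure W} with hCdef
  set L' := (M.E \ W) \ C with hL'def
  set Z := (W \ {b}) ∪ {ℓ, c} with hZdef
  have hWE : W ⊆ M.E := hW.1
  have hCY : C ⊆ M.E \ W := fun t ht => ht.1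
  -- the dual data
  have hnl : ∀ e ∈ M✶.E, M✶.IsNonloop e := fun e he =>
    dual_isNonloop_of_coloopFree M hcol (by rwa [Matroid.dual_ground] at he)
  have hnt' := dual_no_parallel_triple M hcol hnt
  have hWB : M✶.IsBase W := isBase_dual_of_mem_biIndep_five M hν hW
  have hY : M✶.E \ W = C ∪ L' := by
    rw [Matroid.dual_ground, hL'def, Set.union_sdiff_cancel hCY]
  have hdj : Disjoint C L' := Set.disjoint_sdiff_right
  have hL2 : M✶.eRk L' ≤ 2 := bad_line_eRk_le_two M hν.le hW hC3
  have hL4 : 4 ≤ L'.ncard := by rw [hL'def, bad_line_ncard M hW hC3]; omega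
  obtain ⟨hZsp, hEZsp, hcolZ⟩ :=
    typeB_target_valid hν hnl hnt' hWB hb hY hdj hL2 hL4 hC3 hℓ hc hZ hval
  -- membership facts
  have hℓE : ℓ ∈ M.E := hℓ.1.1
  have hcE : c ∈ M.E := hc.1.1
  have hℓW : ℓ ∉ W := hℓ.1.2
  have hcW : c ∉ W := hc.1.2
  have hℓc : ℓ ≠ c := fun h => hℓ.2 (h ▸ hc)
  have hbℓ : b ≠ ℓ := fun h => hℓW (h ▸ hb)
  have hbc : b ≠ c := fun h => hcW (h ▸ hb)
  have hZE : Z ⊆ M.E := by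
    intro x hx
    rcases hx with hx | hx
    · exact hWE hx.1
    · rcases hx with rfl | rfl
      · exact hℓE
      · exact hcE
  have hbZ : b ∉ Z := by
    rintro (h | h)
    · exact h.2 rfl
    · rcases h with h | h
      · exact hbℓ h
      · exact hbc h
  -- the cardinality of `Z`
  have hWfin : W.Finite := M.ground_finite.subset hWE
  have hZcard : Z.ncard = 6 := by
    have h1 : (W \ {b}).ncard = 4 := by rw [Set.ncard_sdiff_singleton_of_mem hb, hW.2.1]
    have hcW' : c ∉ W \ {b} := fun h => hcW h.1
    have hℓW' : ℓ ∉ insert c (W \ {b}) := by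
      rintro (h | h)
      · exact hℓc h
      · exact hℓW h.1
    have e : Z = insert ℓ (insert c (W \ {b})) := by
      rw [hZdef]; ext x
      simp only [Set.mem_union, Set.mem_insert_iff, Set.mem_singleton_iff]; tauto
    rw [e, Set.ncard_insert_of_notMem hℓW' ((hWfin.sdiff).insert c),
      Set.ncard_insert_of_notMem hcW' hWfin.sdiff, h1]
  -- `Z ∈ biIndep M 6`
  have hZmem : Z ∈ biIndep M 6 := by
    refine ⟨hZE, hZcard, ?_, ?_⟩
    · exact indep_of_dual_spanning_compl M hZE (by rw [← Matroid.dual_ground] at hEZsp ⊢; exact hEZsp)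
    · refine indep_of_dual_spanning_compl M Set.sdiff_subset ?_
      rw [Set.sdiff_sdiff_cancel_left hZE]
      exact hZsp
  refine ⟨hZmem, hbZ, ?_⟩
  intro t ht
  have htC : t ∈ C := ht.1
  have htc : t ≠ c := fun h => ht.2 (by rw [Set.mem_singleton_iff]; exact h)
  have htE : t ∈ M.E := htC.1.1
  have htW : t ∉ W := htC.1.2
  have htℓ : t ≠ ℓ := fun h => hℓ.2 (h ▸ htC)
  have htb : t ≠ b := fun h => htW (h ▸ hb)
  have htZ : t ∉ Z := by
    rintro (h | h)
    · exact htW h.1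
    · rcases h with h | h
      · exact htℓ h
      · exact htc h
  have htEZ : t ∈ M.E \ Z := ⟨htE, htZ⟩
  -- `t ∈ cl_M Z` through the dual reading of the closure
  have hdual := compl_closure_eq_dual_coloops M hZmem
  have hnot : ¬ M✶.Spanning ((M✶.E \ Z) \ {t}) := hcolZ t ht
  have hEZ' : M✶.E \ Z = M.E \ Z := by rw [Matroid.dual_ground]
  rw [hEZ'] at hnot hEZsp
  have htcl : t ∉ M✶.closure ((M.E \ Z) \ {t}) := fun h =>
    hnot ((spanning_sdiff_singleton_iff hEZsp htEZ).mpr h)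
  have hmem : t ∈ {t ∈ M.E \ Z | t ∈ M.closure Z} := by rw [hdual]; exact ⟨htEZ, htcl⟩
  exact ⟨⟨htEZ, by rw [Set.mem_singleton_iff]; exact htb⟩, hmem.2⟩

end PercRepro
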